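import Literature.MathematicalPhysics.QuantumFieldTheory.Balaban1983to89.Node00.Record12CarriersB12Package
import Literature.MathematicalPhysics.QuantumFieldTheory.Balaban1983to89.Node00.CarriersB12FundamentalCase
import Literature.MathematicalPhysics.QuantumFieldTheory.Balaban1983to89.Node00.Record12Residuals
import Literature.MathematicalPhysics.QuantumFieldTheory.Balaban1983to89.Node00.Record13NumericsOfThm1CCMW
import Literature.MathematicalPhysics.QuantumFieldTheory.Balaban1983to89.Node00.Record13CarriersXPinnedH

/-!
# NODE N09 ([Balaban1987RG1] Lemma 4 (3.53) p. 280) — THE CONJUNCT-1 LEAF `B12LeafOfRecord Rz cB λ` AT THE RESIDUAL §2 DATA OF RECORD `RzOfRecord` (def-T's UNIT recipe)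
# FROM THE SIZE HALF OF THE BY-REFERENCE PACKAGE ONLY: since condition (iv) (I.1.16) is IDLE at the frames of record over the unit recipe (companion
# `…N09B12PackageAtRzOfRecordLocated` §1), lit-balaban p07's Part-2 assembly `B12Lemma4Space.ofBackground_mem_space'_lemma4` + `B12CondIIIJConcreteModels.analyticAt_pair_lemma4`
# give g32's leaf WITHOUT the identity fields (3.38) ∕ (3.39)+(3.37) ∕ (3.42), WITHOUT the gauge-cost letters and WITHOUT the (J2)∕(J3) second-difference inputs of `JInputs` — the
# displayed inputs are nine SIZE fields + `𝔤ᶜ`-valuedness + the analyticity pair; at `RzOfRecord F N K`, at a Stage-12 parameter with `HasResidualsOfRecord`, at the four-pin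
# engine's N09 socket `θ.pinX3H λ₈ λ₁₂ λ₁₃` and at the V17∕V18 witness `θ₁₅ᶜᶜᴹᵂ` BY NAME

T. Bałaban, *Renormalization group approach to lattice gauge field theories. I*, Commun. Math. Phys. **109** (1987) 249–301 [Balaban1987RG1] (= [I]);
[15] = [Balaban1985Variational], Commun. Math. Phys. **102** (1985) 277–309.  TRACK A (YM-PLAN §2b), WIDTH SEAT `pub-ymgap-dag-n09-w4` (HUMAN RULING D-0149 ∕
director-ym №197; w4 = overflow seat of node n09; third piece under W-SEAT-START-LIST §n09 item 1's package currency, disjoint from items 1–3).  Key of record it serves: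
K1⁷ `StabilityBAtRecordR13SepCoPH` = stmt-QuantumFields-20542 (`--supports`, helper; count-neutral).

WHY.  W-SEAT-START-LIST §n09 item 1 asks the width seats to instantiate node00-def-B12's `B12Package` fields «at the ₁₃ objects».  The companion pair recorded what the
IDENTITY fields can say there (flat letters only) and that the honest horn `B12Provisos` is junk-inhabitable.  THIS FILE is the POSITIVE twin: AT THE RECORD AS IT STANDS
(`Rz = RzOfRecord`, the unit recipe `U_n(M˙(·)) ≡ 1`, `J_n ≡ 0` — `theta13OfThm1CCMW_Rz` `rfl`, `Stage12Params.HasResidualsOfRecord.Rz_eq`), the leaf the DAG reads —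
`B12LeafOfRecord Rz cB λ = B12Sec2to5.Lemma4Printed (F12OfRecord Rz cB λ) λ.consts` — needs ONLY the size half of p07's by-reference package.  Print (pp. 277–280) proves the
membership (3.53) by establishing (i)–(iii) from the sizes (3.37), (3.41), (3.45), (3.50) and the J-bound («The second is proved in the same way», p. 280), and (iv) «from the
corresponding identity (3.38)»; p07 typed exactly this split (`B12Lemma4Space`: (i)–(iii) from the sizes, (iv) data-level).  At the unit recipe (iv) holds for EVERY
configuration (`|∂1 − 1| = 0 < α₀ξ²`, `|0| < α₀(Lⁿξ)²`), so the identity (3.38) drops out, and the identities (3.39)+(3.37) ∕ (3.42) with the four gauge-cost letters and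
(J2)∕(J3) — which in p07's `lemma4Printed_frameOf` manufacture the (3.41)-type plaquette input resp. the J-half from the upper-space datum — are replaced by those two inputs
DISPLAYED DIRECTLY (`h41`, `hJ`; p07's own Part-2 interface): what stays displayed, per input `(𝐔, 𝐀, τ, B′)` of the printed domain, is
∃ `𝐇, ℓ` with — `h41` the (3.41)-type bound `|∂(exp iξ𝐇) − 1| < e^{…}(1+2β)α₀(L⁻¹η)²` on `X`, `hH` (3.37) `|𝐇| < B₃²O(1)Mα₀·L^{j−1}η` on `□̃³`, `h45` (3.45), `hK`∕`hK1`∕`h45τ` the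
(3.37)∕(3.45) sizes of `𝐊 = 𝐇_j(□₀, τQ(…))`, `hA`∕`hdA` the (3.50) sizes `|𝐀₂|, |∇𝐀₂| ≤ B₃|B′|`, `hJ` the J-half `|J(exp iξ(𝐊 + 𝐀₂))| < α₀` on `X` — and `𝔤ᶜ`-valuedness of the
letters; globally «all the restrictions» (the antecedent of `Lemma4Printed`) + the three further restrictions `B₃ ≥ 1`, `B₃²O(1)M ≥ 1`, `16·O(1)Mα₁ ≤ β`, the located geometry
`X ⊆ □̃³` (dag-n09-c's region theorems) and the analyticity pair `hKan`∕`hA2an` (dag-n09-w1's item).  LOCATED READING (SAID, as in def-T `Record12Residuals` §3 (viii)): this leaf is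
WEAKER than print's Lemma 4 exactly by the enlargement of the record's spaces (their (iv) is idle); print's (iv)∕(3.38) content returns only when 11b's `Sect2.Residual.bgI` is pinned
to the minimisers of record.  A NEW importing module; THEOREMS ONLY, def-free, sorry-free, standard axioms; everything consumed BY NAME.

WHAT IS PROVED.  §1 (private faces ∕ (iv) ∕ scale arithmetic) `b12LeafOfRecord_of_eq_unit_of_sizes` (general `Rz =` unit recipe).  §2 `b12LeafOfRecord_RzOfRecord_of_sizes`
(at `RzOfRecord F N K`), `b12LeafOfRecord₁₂_iff_RzOfRecord` (Stage-12 θ with `HasResidualsOfRecord`: `B12LeafOfRecord₁₂ θ λ₁₂ P ↔ B12LeafOfRecord (RzOfRecord F N P.K) θ.s2.cB (λ₁₂ P)`),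
`socket09_pinX3H_iff_b12LeafOfRecord_RzOfRecord` (Stage-13 θ with `HasResidualsOfRecord`: the four-pin engine's N09 socket at `θ.pinX3H λ₈ λ₁₂ λ₁₃`, dag-n05-d's `socket09_pinX3H_iff`,
IS that leaf), `socket09_pinX3H_theta13OfThm1CCMW_iff` (at `θ₁₅ᶜᶜᴹᵂ` by name).

HONEST FRAMING: by-name composition (p07's Part-2 assembly + r20's models + dag-n09-c's geometry + the companion's (iv) lemma re-proved privately); every input is a DISPLAYED
hypothesis, located in print, none asserted; NO estimate of Bałaban's is proved; N09 NOT discharged; K0⁷ ∕ K1⁷ NOT closed; count-neutral; one finite four-torus programme at fixed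
`ε = L^{−K}` per run — conditional finite-𝕋⁴ bookkeeping; R4 closes rung `BalabanLadder.UV` only; NOT ℝ⁴, NOT infinite volume, NOT OS, NOT a mass gap, NOT Clay.
-/

noncomputable section

namespace Summit.QuantumFields.YangMills.BalabanUVNodes.N09B12LeafAtRzOfRecordOfSizes

open Literature.MathematicalPhysics.QuantumFieldTheory.Balaban1983to89
open Literature.MathematicalPhysics.QuantumFieldTheory.Balaban1983to89.Node00
open Literature.MathematicalPhysics.QuantumFieldTheory.Balaban1983to89.T4Continuum (T4Family)
open B12RegularSpaces111 (Frame Region StepConsts space space' expI grad CondIV Satisfies SatisfiesI_III plaq gaugeU)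
open B12RegularSpaces111Mono (plaq_one)
open B12Eq18Current (ofBackground current)
open B12RegularSpaces111SpecialUnitary (suModel)
open B12Lemma4Models (slProj slProj_mem_suModel_gc suModel_heGc suModel_hgc_Gc)
open B12Lemma4ConcreteFrame (LettersAnalyticAt)
open scoped Matrix.Norms.L2Operator

/-! ## §1. The leaf at the unit recipe from the size half of the by-reference package -/

section Sizes

variable {P : Params} {N M : ℕ} {Rz : Sect2.Residual P (MatA N)}

/-- FACE (private copy of the companion's `bg_Un_frameX_of_eq_unit`). [cite: Balaban1987RG1, (1.15) p.262 (bookkeeping)] -/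
private theorem bg_Un_frameX (hRz : Rz = Sect2.Residual.unit P (MatA N)) (lam : ResidB12Run P N M) (m : ℕ) (V : PBond P 0 → (MatA N)ˣ) :
    (lam.frameX Rz).bg.Un m V = 1 := by
  subst hRz; rfl

/-- FACE (private copy of the companion's `bg_Jn_frameX_of_eq_unit`). [cite: Balaban1987RG1, (1.15) p.262 (bookkeeping)] -/
private theorem bg_Jn_frameX (hRz : Rz = Sect2.Residual.unit P (MatA N)) (lam : ResidB12Run P N M) (m : ℕ) (V : PBond P 0 → (MatA N)ˣ) :
    (lam.frameX Rz).bg.Jn m V = 0 := by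
  subst hRz; rfl

/-- (iv) at the frame of `X` holds for every configuration (private copy of the companion's `condIV_frameX_of_eq_unit`). [cite: Balaban1987RG1, (1.15)–(1.16) p.262] -/
private theorem condIV_frameX (hRz : Rz = Sect2.Residual.unit P (MatA N)) (lam : ResidB12Run P N M) (cB : ℝ) {α₀ : ℝ} (hα₀ : 0 < α₀)
    (V : PBond P 0 → (MatA N)ˣ) : CondIV (lam.frameX Rz).bg (lam.frameX Rz).X₂ (lam.csX cB) α₀ V := by
  have hξ : 0 < (lam.csX cB).ξ := pow_pos (inv_pos.mpr (Nat.cast_pos.mpr P.L_pos)) _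
  have hL : 0 < (lam.csX cB).L := Nat.cast_pos.mpr P.L_pos
  refine ⟨fun n _ _ p _ => ?_, fun n _ _ b _ => ?_⟩
  · rw [bg_Un_frameX hRz, plaq_one, Units.val_one, sub_self, norm_zero]
    positivity
  · rw [bg_Jn_frameX hRz, Pi.zero_apply, norm_zero]
    positivity

/-- `1 ≤ L` (real). [cite: Balaban1987RG1, §0 p.251 (bookkeeping)] -/
private theorem one_le_L_real : 1 ≤ (P.L : ℝ) := by exact_mod_cast P.L_pos

/-- `η_k ≤ 1`. [cite: Balaban1987RG1, (1.2) p.260 (bookkeeping)] -/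
private theorem eta_le_one (k : ℕ) : P.eta k ≤ 1 :=
  pow_le_one₀ (inv_nonneg.mpr (Nat.cast_pos.mpr P.L_pos).le) (inv_le_one_of_one_le₀ one_le_L_real)

/-- `Lʲ · η_k ≤ 1` for `j ≤ k`. [cite: Balaban1987RG1, p.279 («j ≤ k, hence Lʲη ≤ 1»)] -/
private theorem L_pow_mul_eta_le {j k : ℕ} (hjk : j ≤ k) : (P.L : ℝ) ^ j * P.eta k ≤ 1 := by
  obtain ⟨m, rfl⟩ := Nat.exists_eq_add_of_le hjk
  rw [Params.eta, pow_add, ← mul_assoc, ← mul_pow, mul_inv_cancel₀ (Sect2.L_cast_ne_zero P), one_pow, one_mul]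
  exact pow_le_one₀ (inv_nonneg.mpr (Nat.cast_pos.mpr P.L_pos).le) (inv_le_one_of_one_le₀ one_le_L_real)

/-- `η_j · (L^{j−1} · η_k) = L⁻¹ · η_k` for `1 ≤ j`. [cite: Balaban1987RG1, p.275 («ξ·L^{j−1}η = L⁻¹η»)] -/
private theorem eta_mul_scale {j : ℕ} (hj : 1 ≤ j) (k : ℕ) : P.eta j * ((P.L : ℝ) ^ (j - 1) * P.eta k) = (P.L : ℝ)⁻¹ * P.eta k := by
  obtain ⟨m, rfl⟩ := Nat.exists_eq_add_of_le hj
  rw [Nat.add_sub_cancel_left, ← mul_assoc, Params.eta, pow_add, pow_one, mul_assoc ((P.L : ℝ)⁻¹), ← mul_pow,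
    inv_mul_cancel₀ (Sect2.L_cast_ne_zero P), one_pow, mul_one]

/-- **N09's CONJUNCT-1 LEAF AT THE UNIT RECIPE FROM THE SIZE HALF OF THE BY-REFERENCE PACKAGE**: for `Rz =` def-T's unit recipe, `0 < O(1)LMB`, an instance with `X ⊆ □̃³`,
the three further restrictions `B₃ ≥ 1`, `B₃²O(1)M ≥ 1`, `16·O(1)Mα₁ ≤ β`, and — for every input `(𝐔, 𝐀, τ, B′)` of the printed domain — `𝔤ᶜ`-valued letters and SOME `𝐇, ℓ` with
the nine size fields `h41` ((3.41)-type plaquette bound of `exp iξ𝐇` on `X`), `hH` (3.37), `h45` (3.45), `hK`∕`hK1`∕`h45τ` ((3.37)∕(3.45) for `𝐊`), `hA`∕`hdA` ((3.50)), `hJ` (J-half on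
`X`), plus the analyticity pair `hKan`∕`hA2an`: g32's leaf `B12LeafOfRecord Rz cB λ` — membership by p07's `B12Lemma4Space.ofBackground_mem_space'_lemma4` with (iv) supplied for
EVERY configuration (idle at the unit recipe), analyticity by r20's `analyticAt_pair_lemma4`.  NO identity field, NO gauge-cost letter, NO (J2)∕(J3).  CONDITIONAL on every displayed
input; NOT a discharge of N09; weaker than print's Lemma 4 by the located enlargement of the record's spaces.
[cite: Balaban1987RG1, Lemma 4 (3.53) p.280 with (3.37) p.277, (3.41) p.278, (3.45) p.279, (3.50)–(3.52) p.280, (1.11)–(1.16) p.262] -/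
theorem b12LeafOfRecord_of_eq_unit_of_sizes (hRz : Rz = Sect2.Residual.unit P (MatA N)) {cB : ℝ} (hcB : 0 < cB) (lam : ResidB12Run P N M)
    (hX3 : lam.idx.XSites ⊆ lam.idx.boxT 3)
    (hB : 1 ≤ lam.consts.B₃) (hY : 1 ≤ lam.consts.B₃ ^ 2 * lam.consts.O₁ * lam.consts.M) (hα₁ : 16 * (lam.consts.O₁ * lam.consts.M * lam.consts.α₁) ≤ lam.consts.β)
    (sizes : ∀ (Φ : FieldPair P 0 (MatA N)ˣ (MatA N)) (A : PBond P 0 → MatA N) (τ : ℝ) (B' : PBond P 0 → MatA N),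
      Φ ∈ space (suModel N) (lam.frameBox Rz) (lam.csBox cB) ((1 + 2 * lam.consts.β) * lam.consts.α₀) ((1 + 2 * lam.consts.β) * lam.consts.α₁) lam.α₀ →
        A ∈ lam.A331 → 0 ≤ τ → τ ≤ 1 → ‖B'‖ < lam.consts.α₃ →
        (∀ b, lam.K Φ A τ b ∈ (suModel N).gc) ∧ (∀ b, lam.A₂ Φ A τ B' b ∈ (suModel N).gc) ∧
        ∃ (H : PBond P 0 → MatA N) (ℓ : Plaq P 0 → MatA N),
          (∀ p ∈ (lam.frameX Rz).X.plaqs, ‖((plaq (fun b => expI (lam.csX cB).ξ (H b)) p : (MatA N)ˣ) : MatA N) - 1‖ <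
            Real.exp (lam.consts.B₃ ^ 2 * lam.consts.O₁ * lam.consts.M * lam.consts.α₀) * Real.exp (lam.consts.B₃ * lam.consts.O₁ * lam.consts.M * lam.consts.α₀) *
            Real.exp (lam.consts.B₃ * lam.consts.O₁ * lam.consts.M * lam.consts.α₀) * Real.exp (lam.consts.O₁ * lam.consts.M * lam.consts.α₁) *
            ((1 + 2 * lam.consts.β) * lam.consts.α₀ * (lam.consts.L⁻¹ * lam.idx.η) ^ 2)) ∧
          (∀ b ∈ lam.regionY.bonds, ‖H b‖ < lam.consts.B₃ ^ 2 * lam.consts.O₁ * lam.consts.M * lam.consts.α₀ * (lam.consts.L ^ (lam.idx.j - 1) * lam.idx.η)) ∧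
          (∀ p ∈ (lam.frameX Rz).X.plaqs, ‖((lam.csX cB).ξ : ℂ)⁻¹ • (H ⟨p.src, p.μ⟩ + H ⟨p.src.shift p.μ, p.ν⟩ - H ⟨p.src.shift p.ν, p.μ⟩ - H ⟨p.src, p.ν⟩) - ℓ p‖ <
            lam.consts.B₃ * (lam.consts.B₃ * lam.consts.O₁ * lam.consts.M * lam.consts.α₀ * (lam.consts.L ^ (lam.idx.j - 1) * lam.idx.η)) ^ 2) ∧
          (∀ b ∈ lam.regionY.bonds, ‖lam.K Φ A τ b‖ < lam.consts.B₃ ^ 2 * lam.consts.O₁ * lam.consts.M * lam.consts.α₀ * (lam.consts.L ^ (lam.idx.j - 1) * lam.idx.η)) ∧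
          (∀ q ∈ lam.regionY.dpairs, ‖grad (lam.csX cB).ξ q.2.1 (fun y => lam.K Φ A τ ⟨y, q.2.2⟩) q.1‖ <
            lam.consts.B₃ ^ 2 * lam.consts.O₁ * lam.consts.M * lam.consts.α₀ * (lam.consts.L ^ (lam.idx.j - 1) * lam.idx.η)) ∧
          (∀ p ∈ (lam.frameX Rz).X.plaqs, ‖((lam.csX cB).ξ : ℂ)⁻¹ • (lam.K Φ A τ ⟨p.src, p.μ⟩ + lam.K Φ A τ ⟨p.src.shift p.μ, p.ν⟩ -
              lam.K Φ A τ ⟨p.src.shift p.ν, p.μ⟩ - lam.K Φ A τ ⟨p.src, p.ν⟩) - (τ : ℂ) • ℓ p‖ <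
            lam.consts.B₃ * (lam.consts.B₃ * lam.consts.O₁ * lam.consts.M * lam.consts.α₀ * (lam.consts.L ^ (lam.idx.j - 1) * lam.idx.η)) ^ 2) ∧
          (∀ b ∈ lam.regionY.bonds, ‖lam.A₂ Φ A τ B' b‖ ≤ lam.consts.B₃ * ‖B'‖) ∧
          (∀ q ∈ lam.regionY.dpairs, ‖grad (lam.csX cB).ξ q.2.1 (fun y => lam.A₂ Φ A τ B' ⟨y, q.2.2⟩) q.1‖ ≤ lam.consts.B₃ * ‖B'‖) ∧
          (∀ b ∈ (lam.frameX Rz).X.bonds, ‖current (slProj N) (lam.csX cB).ξ (fun b => expI (lam.csX cB).ξ (lam.K Φ A τ b + lam.A₂ Φ A τ B' b)) b‖ < lam.consts.α₀))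
    (hKan : ∀ {E : Type} [NormedAddCommGroup E] [NormedSpace ℂ E] {Φf : E → FieldPair P 0 (MatA N)ˣ (MatA N)} {Af Bf : E → PBond P 0 → MatA N}
      {e₀ : E} (τ : ℝ), LettersAnalyticAt Φf Af Bf e₀ →
        Φf e₀ ∈ space (suModel N) (lam.frameBox Rz) (lam.csBox cB) ((1 + 2 * lam.consts.β) * lam.consts.α₀) ((1 + 2 * lam.consts.β) * lam.consts.α₁) lam.α₀ →
          Af e₀ ∈ lam.A331 → 0 ≤ τ → τ ≤ 1 → ‖Bf e₀‖ < lam.consts.α₃ → ∀ b, AnalyticAt ℂ (fun e => lam.K (Φf e) (Af e) τ b) e₀)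
    (hA2an : ∀ {E : Type} [NormedAddCommGroup E] [NormedSpace ℂ E] {Φf : E → FieldPair P 0 (MatA N)ˣ (MatA N)} {Af Bf : E → PBond P 0 → MatA N}
      {e₀ : E} (τ : ℝ), LettersAnalyticAt Φf Af Bf e₀ →
        Φf e₀ ∈ space (suModel N) (lam.frameBox Rz) (lam.csBox cB) ((1 + 2 * lam.consts.β) * lam.consts.α₀) ((1 + 2 * lam.consts.β) * lam.consts.α₁) lam.α₀ →
          Af e₀ ∈ lam.A331 → 0 ≤ τ → τ ≤ 1 → ‖Bf e₀‖ < lam.consts.α₃ → ∀ b, AnalyticAt ℂ (fun e => lam.A₂ (Φf e) (Af e) τ (Bf e) b) e₀) :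
    B12LeafOfRecord Rz cB lam := by
  intro hR
  have hα₀ : 0 < lam.consts.α₀ := hR.1
  refine ⟨?_, ?_⟩
  · intro Φ A τ B' hΦ hA hτ0 hτ1 hB'
    obtain ⟨hKgc, hAgc, H, ℓ, h41, hH, h45, hK, hK1, h45τ, hA', hdA, hJ⟩ := sizes Φ A τ B' hΦ hA hτ0 hτ1 hB'
    exact B12Lemma4Space.ofBackground_mem_space'_lemma4 (suModel N) lam.consts hR hB hY hα₁
      (F := lam.frameX Rz) (cs := lam.csX cB) (pow_pos (inv_pos.mpr (Nat.cast_pos.mpr P.L_pos)) _) (eta_le_one lam.idx.j) hcB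
      (pow_pos (inv_pos.mpr (Nat.cast_pos.mpr P.L_pos)) _).le lam.idx.one_le_j (L_pow_mul_eta_le lam.idx.j_le_k)
      (eta_mul_scale lam.idx.one_le_j lam.idx.k) hτ0 hτ1 hB' (suModel_heGc _) (slProj N) slProj_mem_suModel_gc suModel_hgc_Gc
      (lam.frameX_X_bonds_subset_regionY Rz hX3) (lam.frameX_X_dpairs_subset_regionY Rz hX3) (lam.stencil_subset_regionY Rz hX3)
      hKgc hAgc h41 hH h45 hK hK1 h45τ hA' hdA hJ (condIV_frameX hRz lam cB hα₀ _) (condIV_frameX hRz lam cB hα₀ _)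
  · intro E _ _ Φf Af Bf τ e₀ hLe hΦ hA hτ0 hτ1 hB'
    exact B12CondIIIJConcreteModels.analyticAt_pair_lemma4 B12Eq311Models.norm_slProj_le (lam.csX cB).ξ
      (hKan τ hLe hΦ hA hτ0 hτ1 hB') (hA2an τ hLe hΦ hA hτ0 hτ1 hB')

end Sizes

/-! ## §2. At `RzOfRecord F N K`; the Stage-12 leaf and the four-pin engine's N09 socket ARE that leaf at a parameter carrying the residuals of record; at `θ₁₅ᶜᶜᴹᵂ` by name -/

section Record

variable {F : T4Family} {N : ℕ}

/-- **THE LEAF AT `RzOfRecord F N K` FROM THE SIZE HALF** (§1 at def-T's `RzOfRecord`, which IS the unit recipe, `rfl`).  CONDITIONAL; NOT a discharge of N09.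
[cite: Balaban1987RG1, Lemma 4 (3.53) p.280 with (3.37), (3.41), (3.45), (3.50) pp.277–280] -/
theorem b12LeafOfRecord_RzOfRecord_of_sizes {K M : ℕ} {cB : ℝ} (hcB : 0 < cB) (lam : ResidB12Run (F.P K) N M)
    (hX3 : lam.idx.XSites ⊆ lam.idx.boxT 3)
    (hB : 1 ≤ lam.consts.B₃) (hY : 1 ≤ lam.consts.B₃ ^ 2 * lam.consts.O₁ * lam.consts.M) (hα₁ : 16 * (lam.consts.O₁ * lam.consts.M * lam.consts.α₁) ≤ lam.consts.β)
    (sizes : ∀ (Φ : FieldPair (F.P K) 0 (MatA N)ˣ (MatA N)) (A : PBond (F.P K) 0 → MatA N) (τ : ℝ) (B' : PBond (F.P K) 0 → MatA N),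
      Φ ∈ space (suModel N) (lam.frameBox (RzOfRecord F N K)) (lam.csBox cB) ((1 + 2 * lam.consts.β) * lam.consts.α₀) ((1 + 2 * lam.consts.β) * lam.consts.α₁) lam.α₀ →
        A ∈ lam.A331 → 0 ≤ τ → τ ≤ 1 → ‖B'‖ < lam.consts.α₃ →
        (∀ b, lam.K Φ A τ b ∈ (suModel N).gc) ∧ (∀ b, lam.A₂ Φ A τ B' b ∈ (suModel N).gc) ∧
        ∃ (H : PBond (F.P K) 0 → MatA N) (ℓ : Plaq (F.P K) 0 → MatA N),
          (∀ p ∈ (lam.frameX (RzOfRecord F N K)).X.plaqs, ‖((plaq (fun b => expI (lam.csX cB).ξ (H b)) p : (MatA N)ˣ) : MatA N) - 1‖ <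
            Real.exp (lam.consts.B₃ ^ 2 * lam.consts.O₁ * lam.consts.M * lam.consts.α₀) * Real.exp (lam.consts.B₃ * lam.consts.O₁ * lam.consts.M * lam.consts.α₀) *
            Real.exp (lam.consts.B₃ * lam.consts.O₁ * lam.consts.M * lam.consts.α₀) * Real.exp (lam.consts.O₁ * lam.consts.M * lam.consts.α₁) *
            ((1 + 2 * lam.consts.β) * lam.consts.α₀ * (lam.consts.L⁻¹ * lam.idx.η) ^ 2)) ∧
          (∀ b ∈ lam.regionY.bonds, ‖H b‖ < lam.consts.B₃ ^ 2 * lam.consts.O₁ * lam.consts.M * lam.consts.α₀ * (lam.consts.L ^ (lam.idx.j - 1) * lam.idx.η)) ∧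
          (∀ p ∈ (lam.frameX (RzOfRecord F N K)).X.plaqs, ‖((lam.csX cB).ξ : ℂ)⁻¹ • (H ⟨p.src, p.μ⟩ + H ⟨p.src.shift p.μ, p.ν⟩ - H ⟨p.src.shift p.ν, p.μ⟩ - H ⟨p.src, p.ν⟩) - ℓ p‖ <
            lam.consts.B₃ * (lam.consts.B₃ * lam.consts.O₁ * lam.consts.M * lam.consts.α₀ * (lam.consts.L ^ (lam.idx.j - 1) * lam.idx.η)) ^ 2) ∧
          (∀ b ∈ lam.regionY.bonds, ‖lam.K Φ A τ b‖ < lam.consts.B₃ ^ 2 * lam.consts.O₁ * lam.consts.M * lam.consts.α₀ * (lam.consts.L ^ (lam.idx.j - 1) * lam.idx.η)) ∧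
          (∀ q ∈ lam.regionY.dpairs, ‖grad (lam.csX cB).ξ q.2.1 (fun y => lam.K Φ A τ ⟨y, q.2.2⟩) q.1‖ <
            lam.consts.B₃ ^ 2 * lam.consts.O₁ * lam.consts.M * lam.consts.α₀ * (lam.consts.L ^ (lam.idx.j - 1) * lam.idx.η)) ∧
          (∀ p ∈ (lam.frameX (RzOfRecord F N K)).X.plaqs, ‖((lam.csX cB).ξ : ℂ)⁻¹ • (lam.K Φ A τ ⟨p.src, p.μ⟩ + lam.K Φ A τ ⟨p.src.shift p.μ, p.ν⟩ -
              lam.K Φ A τ ⟨p.src.shift p.ν, p.μ⟩ - lam.K Φ A τ ⟨p.src, p.ν⟩) - (τ : ℂ) • ℓ p‖ <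
            lam.consts.B₃ * (lam.consts.B₃ * lam.consts.O₁ * lam.consts.M * lam.consts.α₀ * (lam.consts.L ^ (lam.idx.j - 1) * lam.idx.η)) ^ 2) ∧
          (∀ b ∈ lam.regionY.bonds, ‖lam.A₂ Φ A τ B' b‖ ≤ lam.consts.B₃ * ‖B'‖) ∧
          (∀ q ∈ lam.regionY.dpairs, ‖grad (lam.csX cB).ξ q.2.1 (fun y => lam.A₂ Φ A τ B' ⟨y, q.2.2⟩) q.1‖ ≤ lam.consts.B₃ * ‖B'‖) ∧
          (∀ b ∈ (lam.frameX (RzOfRecord F N K)).X.bonds,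
            ‖current (slProj N) (lam.csX cB).ξ (fun b => expI (lam.csX cB).ξ (lam.K Φ A τ b + lam.A₂ Φ A τ B' b)) b‖ < lam.consts.α₀))
    (hKan : ∀ {E : Type} [NormedAddCommGroup E] [NormedSpace ℂ E] {Φf : E → FieldPair (F.P K) 0 (MatA N)ˣ (MatA N)} {Af Bf : E → PBond (F.P K) 0 → MatA N}
      {e₀ : E} (τ : ℝ), LettersAnalyticAt Φf Af Bf e₀ →
        Φf e₀ ∈ space (suModel N) (lam.frameBox (RzOfRecord F N K)) (lam.csBox cB) ((1 + 2 * lam.consts.β) * lam.consts.α₀) ((1 + 2 * lam.consts.β) * lam.consts.α₁) lam.α₀ →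
          Af e₀ ∈ lam.A331 → 0 ≤ τ → τ ≤ 1 → ‖Bf e₀‖ < lam.consts.α₃ → ∀ b, AnalyticAt ℂ (fun e => lam.K (Φf e) (Af e) τ b) e₀)
    (hA2an : ∀ {E : Type} [NormedAddCommGroup E] [NormedSpace ℂ E] {Φf : E → FieldPair (F.P K) 0 (MatA N)ˣ (MatA N)} {Af Bf : E → PBond (F.P K) 0 → MatA N}
      {e₀ : E} (τ : ℝ), LettersAnalyticAt Φf Af Bf e₀ →
        Φf e₀ ∈ space (suModel N) (lam.frameBox (RzOfRecord F N K)) (lam.csBox cB) ((1 + 2 * lam.consts.β) * lam.consts.α₀) ((1 + 2 * lam.consts.β) * lam.consts.α₁) lam.α₀ →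
          Af e₀ ∈ lam.A331 → 0 ≤ τ → τ ≤ 1 → ‖Bf e₀‖ < lam.consts.α₃ → ∀ b, AnalyticAt ℂ (fun e => lam.A₂ (Φf e) (Af e) τ (Bf e) b) e₀) :
    B12LeafOfRecord (RzOfRecord F N K) cB lam :=
  b12LeafOfRecord_of_eq_unit_of_sizes rfl hcB lam hX3 hB hY hα₁ sizes
    (fun τ hLe hΦ hA hτ0 hτ1 hB' => hKan τ hLe hΦ hA hτ0 hτ1 hB') (fun τ hLe hΦ hA hτ0 hτ1 hB' => hA2an τ hLe hΦ hA hτ0 hτ1 hB')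

variable [NeZero N]

/-- **THE STAGE-12 LEAF IS THE LEAF AT `RzOfRecord`** at a parameter carrying the residuals of record (g32's `B12LeafOfRecord₁₂ θ λ₁₂ P := B12LeafOfRecord (θ.Rz P.K) θ.s2.cB (λ₁₂ P)`,
`Stage12Params.HasResidualsOfRecord.Rz_eq`) — so §2's size-half form supplies it. [cite: Balaban1987RG1, Lemma 4 (3.53) p.280 (bookkeeping)] -/
theorem b12LeafOfRecord₁₂_iff_RzOfRecord {θ : Stage12Params F N} (h : θ.HasResidualsOfRecord F N) (lam12 : ResidB12 F N θ.τ9.M) (P : B12.RunParams) :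
    B12LeafOfRecord₁₂ F N θ lam12 P ↔ B12LeafOfRecord (RzOfRecord F N P.K) θ.s2.cB (lam12 P) := by
  unfold B12LeafOfRecord₁₂
  rw [h.Rz_eq]

/-- **THE FOUR-PIN ENGINE's N09 SOCKET AT THE X-PINNED STAGE-13 PARAMETER IS THE LEAF AT `RzOfRecord`** when the parameter carries the residuals of record (dag-n05-d's
`socket09_pinX3H_iff`, `Iff.rfl`, then `Rz_eq`) — so §2's size-half form supplies `h09` there, for every `λ₈`, `λ₁₃`. [cite: Balaban1987RG1, Lemma 4 (3.53) p.280 (bookkeeping)] -/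
theorem socket09_pinX3H_iff_b12LeafOfRecord_RzOfRecord {θ : Stage13Params F N} (h : θ.HasResidualsOfRecord F N) (lam8 : ResidB8 θ.toStage3Params)
    (lam12 : ResidB12 F N θ.τ9.M) (lam13 : B12.RunParams → ResidB13 θ.toStage3Params) (P : B12.RunParams) :
    B12Sec2to5.Lemma4Printed ((θ.pinX3H F N lam8 lam12 lam13).res.X P).F12 ((θ.pinX3H F N lam8 lam12 lam13).res.X P).c12 ↔
      B12LeafOfRecord (RzOfRecord F N P.K) θ.s2.cB (lam12 P) :=
  (socket09_pinX3H_iff F N θ lam8 lam12 lam13 P).trans (b12LeafOfRecord₁₂_iff_RzOfRecord (θ := θ.toStage12Params) h lam12 P)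

/-- **AT THE V17∕V18 WITNESS `θ₁₅ᶜᶜᴹᵂ(j; γ; ε₀, ε₂₉; B₃, B₃′, a₀, a₁)` BY NAME**: the four-pin engine's N09 socket at `θ₁₅ᶜᶜᴹᵂ.pinX3H λ₈ λ₁₂ λ₁₃` IS the leaf at `RzOfRecord` with `O(1)LMB = θ₁₅ᶜᶜᴹᵂ.s2.cB`
(`hasResidualsOfRecord_theta13OfThm1CCMW`) — the target §2's size-half form closes, CONDITIONALLY on its displayed inputs. [cite: Balaban1987RG1, Lemma 4 (3.53) p.280; Balaban1989LargeFieldI, (0.3) p.176 (the witness, bookkeeping)] -/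
theorem socket09_pinX3H_theta13OfThm1CCMW_iff (j : ℕ) (γ ε₀ ε₂₉ B₃ B₃' a₀ a₁ : ℝ)
    (lam8 : ResidB8 (theta13OfThm1CCMW F N j γ ε₀ ε₂₉ B₃ B₃' a₀ a₁).toStage3Params)
    (lam12 : ResidB12 F N (theta13OfThm1CCMW F N j γ ε₀ ε₂₉ B₃ B₃' a₀ a₁).τ9.M)
    (lam13 : B12.RunParams → ResidB13 (theta13OfThm1CCMW F N j γ ε₀ ε₂₉ B₃ B₃' a₀ a₁).toStage3Params) (P : B12.RunParams) :
    B12Sec2to5.Lemma4Printed (((theta13OfThm1CCMW F N j γ ε₀ ε₂₉ B₃ B₃' a₀ a₁).pinX3H F N lam8 lam12 lam13).res.X P).F12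
        (((theta13OfThm1CCMW F N j γ ε₀ ε₂₉ B₃ B₃' a₀ a₁).pinX3H F N lam8 lam12 lam13).res.X P).c12 ↔
      B12LeafOfRecord (RzOfRecord F N P.K) (theta13OfThm1CCMW F N j γ ε₀ ε₂₉ B₃ B₃' a₀ a₁).s2.cB (lam12 P) :=
  socket09_pinX3H_iff_b12LeafOfRecord_RzOfRecord (hasResidualsOfRecord_theta13OfThm1CCMW F N j γ ε₀ ε₂₉ B₃ B₃' a₀ a₁) lam8 lam12 lam13 P

end Record

end Summit.QuantumFields.YangMills.BalabanUVNodes.N09B12LeafAtRzOfRecordOfSizes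

end
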